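import Summits.KontsevichZagierPeriods.KontsevichZagierPeriods.Theses.SymplecticScissors
import Literature.NumberTheory.Transcendental.AyoubPeriodSeries
import Literature.NumberTheory.Transcendental.AyoubPeriodSeriesKernel
import Literature.NumberTheory.Transcendental.AyoubPeriodSeriesPiAlgebraic
import Literature.NumberTheory.Transcendental.AyoubPeriodSeriesLocalizing
import Literature.NumberTheory.Transcendental.AyoubPeriodSeriesProofs
import Summits.KontsevichZagierPeriods.KontsevichZagierPeriods.Theorems.SymplecticScissorsTypeAGenerationStubDlogOfSmallDeviation

/-!
# `TypeAGeneration` (stmt-KontsevichZagierPeriods-18392), line `Sketch`: bookkeeping for the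
`N`-th-root contraction (helper file of the registered stub `stub_exactDlog_of`, lead, cycle 2)

Generic lemmas over Ayoub's algebra `𝒪_{k-alg}(𝔻̄^∞)` (`AyoubRel.Oan`) used by the exact-dlog
certificate `Σⱼ eⱼ/(zᵢ − αⱼ) ∈ ⟨a⟩_ℚ` (`…StubExactDlog.lean`):

* finite products: membership in `Oan`, variables, the two face maps `zᵢ = 0` (multiplicative)
  and `zᵢ = 1` (multiplicative on absolutely summable series), the constant coefficient;
* the logarithmic derivative of a product, `∂ᵢ(Π gⱼ) = (Π gⱼ) · Σ hⱼ` when `∂ᵢ gⱼ = gⱼ hⱼ`;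
* `G|_{z_j = 1} = G` for `G` free of `z_j`;
* weighted `ℓ¹` bookkeeping in `HasSum` form (sums, the constant `1`, one-variable families
  along an axis) and the DEVIATION OF A PRODUCT: if `N_ρ(gⱼ − 1) ≤ dⱼ` then
  `N_ρ(Π gⱼ − 1) ≤ Π (1 + dⱼ) − 1` (submultiplicativity U0 `stub_weightedNormMul`).

Elementary (folklore); no definition is introduced.
-/

noncomputable section

-- `Summit.KontsevichZagierPeriods.KontsevichZagierPeriods.…` is the tree's mandated layout (single-conjunct summit).
set_option linter.dupNamespace false

namespace Summit.KontsevichZagierPeriods.KontsevichZagierPeriods.TypeAGenerationLine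

open Finsupp MvPowerSeries
open Literature.NumberTheory.Transcendental
open Literature.NumberTheory.Transcendental.AyoubRel

/-! ## Finite products in `𝒪_{k-alg}(𝔻̄^∞)` -/

section Products

variable {k : Type} [Field k] (σ : k →+* ℂ)

/-- A finite product of elements of `𝒪_{k-alg}(𝔻̄^∞)` lies in `𝒪_{k-alg}(𝔻̄^∞)`. [folklore] -/
theorem d1_prod_mem_Oan {ι : Type*} (s : Finset ι) (g : ι → CSeries)
    (hg : ∀ j ∈ s, g j ∈ Oan σ) : ∏ j ∈ s, g j ∈ Oan σ := by
  classical
  induction s using Finset.induction_on with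
  | empty => simpa using one_mem_Oan σ
  | insert a s ha ih =>
    rw [Finset.prod_insert ha]
    exact mul_mem_Oan σ (hg a (Finset.mem_insert_self a s))
      (ih fun j hj => hg j (Finset.mem_insert_of_mem hj))

omit [Field k] in
/-- A variable used by a finite product is used by one of the factors. [folklore] -/
theorem d1_usesVar_prod {ι : Type*} (s : Finset ι) (g : ι → CSeries) {l : ℕ}
    (h : UsesVar (∏ j ∈ s, g j) l) : ∃ j ∈ s, UsesVar (g j) l := by
  classical
  induction s using Finset.induction_on with
  | empty =>
    rw [Finset.prod_empty] at h
    exact absurd h (not_usesVar_one l)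
  | insert a s ha ih =>
    rw [Finset.prod_insert ha] at h
    rcases usesVar_mul h with h' | h'
    · exact ⟨a, Finset.mem_insert_self a s, h'⟩
    · obtain ⟨j, hj, hj'⟩ := ih h'
      exact ⟨j, Finset.mem_insert_of_mem hj, hj'⟩

omit [Field k] in
/-- The face map `zᵢ = 0` is multiplicative on finite products. [folklore] -/
theorem d1_restrC_zero_prod (i : ℕ) {ι : Type*} (s : Finset ι) (g : ι → CSeries) :
    restrC i 0 (∏ j ∈ s, g j) = ∏ j ∈ s, restrC i 0 (g j) := by
  classical
  induction s using Finset.induction_on with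
  | empty =>
    rw [Finset.prod_empty, Finset.prod_empty]
    simpa using s8_restrC_zero_C i (1 : ℂ)
  | insert a s ha ih =>
    rw [Finset.prod_insert ha, Finset.prod_insert ha, s8_restrC_zero_mul, ih]

/-- The face map `zᵢ = 1` is multiplicative on finite products of elements of `𝒪_{k-alg}(𝔻̄^∞)`
(absolutely summable coefficients). [folklore] -/
theorem d1_restrC_one_prod (i : ℕ) {ι : Type*} (s : Finset ι) (g : ι → CSeries)
    (hg : ∀ j ∈ s, g j ∈ Oan σ) :
    restrC i 1 (∏ j ∈ s, g j) = ∏ j ∈ s, restrC i 1 (g j) := by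
  classical
  induction s using Finset.induction_on with
  | empty =>
    rw [Finset.prod_empty, Finset.prod_empty, s4_restrC_one]
  | insert a s ha ih =>
    rw [Finset.prod_insert ha, Finset.prod_insert ha,
      s4_restrC_mul (summable_norm_coeff_of_mem_Oan σ (hg a (Finset.mem_insert_self a s)))
        (summable_norm_coeff_of_mem_Oan σ
          (d1_prod_mem_Oan σ s g fun j hj => hg j (Finset.mem_insert_of_mem hj))),
      ih fun j hj => hg j (Finset.mem_insert_of_mem hj)]

omit [Field k] in
/-- **Logarithmic derivative of a product**: if `∂ᵢ gⱼ = gⱼ hⱼ` for every factor then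
`∂ᵢ (Π gⱼ) = (Π gⱼ) Σ hⱼ` (Leibniz rule `w1_pdz_mul`). [folklore] -/
theorem d1_pdz_prod_of_dlog (i : ℕ) {ι : Type*} (s : Finset ι) (g h : ι → CSeries)
    (hg : ∀ j ∈ s, pdz i (g j) = g j * h j) :
    pdz i (∏ j ∈ s, g j) = (∏ j ∈ s, g j) * ∑ j ∈ s, h j := by
  classical
  induction s using Finset.induction_on with
  | empty =>
    rw [Finset.prod_empty, Finset.sum_empty, mul_zero]
    simpa using w1_pdz_C i (1 : ℂ)
  | insert a s ha ih =>
    rw [Finset.prod_insert ha, Finset.sum_insert ha, w1_pdz_mul,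
      ih fun j hj => hg j (Finset.mem_insert_of_mem hj), hg a (Finset.mem_insert_self a s)]
    ring

omit [Field k] in
/-- `G|_{z_j = 1} = G` for `G` free of `z_j`. [folklore] -/
theorem d1_restrC_one_of_not_usesVar {G : CSeries} {j : ℕ} (h : ¬ UsesVar G j) :
    restrC j 1 G = G := by
  have hz : ∀ a : ℕ →₀ ℕ, a j ≠ 0 → coeff a G = 0 := by
    intro a ha
    by_contra hne
    exact h ⟨a, ha, hne⟩
  ext a
  rw [s4_coeff_restrC_one]
  split_ifs with ha
  · rw [tsum_eq_single 0 fun n hn => ?_]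
    · rw [single_zero, add_zero]
    · refine hz _ ?_
      rwa [Finsupp.add_apply, ha, single_eq_same, zero_add]
  · exact (hz a ha).symm

end Products

/-! ## Weighted `ℓ¹` bookkeeping -/

section Weights

/-- `N_ρ(F + G) ≤ N_ρ(F) + N_ρ(G)` in `HasSum` form. [folklore] -/
theorem d1_hasSum_norm_add {ρ : ℕ → ℝ} (hρ : ∀ l, 0 ≤ ρ l) {F G : CSeries} {A B : ℝ}
    (hA : HasSum (fun a : ℕ →₀ ℕ => ‖coeff a F‖ * a.prod fun l n => ρ l ^ n) A)
    (hB : HasSum (fun a : ℕ →₀ ℕ => ‖coeff a G‖ * a.prod fun l n => ρ l ^ n) B) :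
    ∃ P : ℝ, P ≤ A + B ∧
      HasSum (fun a : ℕ →₀ ℕ => ‖coeff a (F + G)‖ * a.prod fun l n => ρ l ^ n) P := by
  have hle : ∀ a : ℕ →₀ ℕ, ‖coeff a (F + G)‖ * (a.prod fun l n => ρ l ^ n) ≤
      ‖coeff a F‖ * (a.prod fun l n => ρ l ^ n) + ‖coeff a G‖ * (a.prod fun l n => ρ l ^ n) := by
    intro a
    rw [← add_mul, map_add]
    exact mul_le_mul_of_nonneg_right (norm_add_le _ _) (s3_wprod_nonneg hρ a)
  have h0 : ∀ a : ℕ →₀ ℕ, 0 ≤ ‖coeff a (F + G)‖ * (a.prod fun l n => ρ l ^ n) :=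
    fun a => mul_nonneg (norm_nonneg _) (s3_wprod_nonneg hρ a)
  have hS : Summable fun a : ℕ →₀ ℕ => ‖coeff a (F + G)‖ * a.prod fun l n => ρ l ^ n :=
    (hA.add hB).summable.of_nonneg_of_le h0 hle
  exact ⟨_, hasSum_le hle hS.hasSum (hA.add hB), hS.hasSum⟩

/-- `N_ρ(1) = 1`. [folklore] -/
theorem d1_hasSum_norm_one (ρ : ℕ → ℝ) :
    HasSum (fun a : ℕ →₀ ℕ => ‖coeff a (1 : CSeries)‖ * a.prod fun l n => ρ l ^ n) 1 := by
  have h : (fun a : ℕ →₀ ℕ => ‖coeff a (1 : CSeries)‖ * a.prod fun l n => ρ l ^ n) =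
      fun a => if a = 0 then 1 else 0 := by
    funext a
    rw [coeff_one]
    split_ifs with ha
    · subst ha
      simp
    · rw [norm_zero, zero_mul]
  rw [h]
  simpa using hasSum_ite_eq (0 : ℕ →₀ ℕ) (1 : ℝ)

/-- `N_ρ(c • F) = ‖c‖ N_ρ(F)`. [folklore] -/
theorem d1_hasSum_norm_smul {ρ : ℕ → ℝ} (c : ℂ) {F : CSeries} {A : ℝ}
    (hA : HasSum (fun a : ℕ →₀ ℕ => ‖coeff a F‖ * a.prod fun l n => ρ l ^ n) A) :
    HasSum (fun a : ℕ →₀ ℕ => ‖coeff a (c • F)‖ * a.prod fun l n => ρ l ^ n) (‖c‖ * A) := by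
  refine (hA.mul_left ‖c‖).congr_fun fun a => ?_
  rw [coeff_smul, norm_mul, mul_assoc]

/-- **Deviation of a product**: if `N_ρ(gⱼ − 1) ≤ dⱼ` for every factor then
`N_ρ(Πⱼ gⱼ − 1) ≤ Πⱼ (1 + dⱼ) − 1` (induction: `Π' g − 1 = (Π g − 1) g_a + (g_a − 1)`,
`N_ρ(g_a) ≤ 1 + d_a`, submultiplicativity U0). [folklore] -/
theorem d1_prod_deviation {ρ : ℕ → ℝ} (hρ : ∀ l, 0 ≤ ρ l) {ι : Type*} (s : Finset ι)
    (g : ι → CSeries) (d : ι → ℝ)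
    (hg : ∀ j ∈ s, ∃ D : ℝ, D ≤ d j ∧
      HasSum (fun a : ℕ →₀ ℕ => ‖coeff a (g j - 1)‖ * a.prod fun l n => ρ l ^ n) D) :
    ∃ P : ℝ, P ≤ (∏ j ∈ s, (1 + d j)) - 1 ∧
      HasSum (fun a : ℕ →₀ ℕ => ‖coeff a ((∏ j ∈ s, g j) - 1)‖ * a.prod fun l n => ρ l ^ n) P := by
  classical
  induction s using Finset.induction_on with
  | empty =>
    refine ⟨0, by simp, ?_⟩
    rw [Finset.prod_empty, sub_self]
    simp [hasSum_zero]
  | insert a s ha ih =>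
    obtain ⟨P, hP, hPs⟩ := ih fun j hj => hg j (Finset.mem_insert_of_mem hj)
    obtain ⟨D, hD, hDs⟩ := hg a (Finset.mem_insert_self a s)
    -- `N(g_a) ≤ D + 1`
    obtain ⟨Q, hQ, hQs⟩ := d1_hasSum_norm_add hρ hDs (d1_hasSum_norm_one ρ)
    rw [sub_add_cancel] at hQs
    -- `N((Π g − 1) g_a) ≤ P Q`
    obtain ⟨R, hR, hRs⟩ := stub_weightedNormMul _ _ ρ hρ _ _ hPs hQs
    -- `N((Π g − 1) g_a + (g_a − 1)) ≤ R + D`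
    obtain ⟨T, hT, hTs⟩ := d1_hasSum_norm_add hρ hRs hDs
    have h0 : ∀ (H : CSeries) (b : ℕ →₀ ℕ), 0 ≤ ‖coeff b H‖ * b.prod fun l n => ρ l ^ n :=
      fun H b => mul_nonneg (norm_nonneg _) (s3_wprod_nonneg hρ b)
    have hD0 : 0 ≤ D := hDs.nonneg (h0 _)
    have hd0 : 0 ≤ d a := hD0.trans hD
    have hprod0 : 1 ≤ ∏ j ∈ s, (1 + d j) := by
      have h1 : ∏ j ∈ s, (1 : ℝ) ≤ ∏ j ∈ s, (1 + d j) := by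
        refine Finset.prod_le_prod (fun _ _ => zero_le_one) fun j hj => ?_
        obtain ⟨Dj, hDj, hDjs⟩ := hg j (Finset.mem_insert_of_mem hj)
        have := hDjs.nonneg (h0 _)
        linarith
      rwa [Finset.prod_const_one] at h1
    refine ⟨T, ?_, ?_⟩
    · rw [Finset.prod_insert ha]
      have h1 : R ≤ ((∏ j ∈ s, (1 + d j)) - 1) * (1 + d a) := by
        refine hR.trans ?_
        exact mul_le_mul hP (hQ.trans (by linarith)) (hQs.nonneg (h0 _)) (by linarith)
      nlinarith
    · have he : (∏ j ∈ insert a s, g j) - 1 = ((∏ j ∈ s, g j) - 1) * g a + (g a - 1) := by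
        rw [Finset.prod_insert ha]
        ring
      rwa [he]

/-- Along the `zᵢ`-axis: for `G` supported on the monomials `zᵢⁿ` and a constant weight `ρ₀`,
`Σ_a ‖G_a‖ ρ₀^{|a|} = Σ_n ‖G_{n eᵢ}‖ ρ₀ⁿ` (transport along the injection `n ↦ n eᵢ`). [folklore] -/
theorem d1_hasSum_axis {i : ℕ} {G : CSeries}
    (hG : ∀ x : ℕ →₀ ℕ, (∀ n : ℕ, x ≠ single i n) → coeff x G = 0) (ρ₀ : ℝ) {S : ℝ}
    (hS : HasSum (fun n : ℕ => ‖coeff (single i n) G‖ * ρ₀ ^ n) S) :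
    HasSum (fun a : ℕ →₀ ℕ => ‖coeff a G‖ * a.prod fun _ n => ρ₀ ^ n) S := by
  refine ((single_injective i).hasSum_iff ?_).mp ?_
  · intro x hx
    rw [hG x fun n hn => hx ⟨n, hn.symm⟩, norm_zero, zero_mul]
  · refine hS.congr_fun fun n => ?_
    simp only [Function.comp_apply]
    rw [s4_weight_single (fun _ => ρ₀) i n]

/-- **Registered helper `stub_exactDlogAux` (line `Sketch`, lead) — deviation of a finite product
in the weighted `ℓ¹` norm**: if `N_ρ(gⱼ − 1) ≤ dⱼ` for `j < m` then `N_ρ(Πⱼ gⱼ − 1) ≤ Πⱼ (1 + dⱼ) − 1`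
(the estimate that makes the `N`-th-root contraction `Π (1 − zᵢ/αⱼ)^{eⱼ/N}` a small-deviation
loop for `N ≫ 0`). [folklore] -/
theorem stub_exactDlogAux :
    ∀ (ρ : ℕ → ℝ), (∀ l, 0 ≤ ρ l) → ∀ (m : ℕ) (g : Fin m → CSeries) (d : Fin m → ℝ),
      (∀ j, ∃ D : ℝ, D ≤ d j ∧
        HasSum (fun a : ℕ →₀ ℕ => ‖MvPowerSeries.coeff a (g j - 1)‖ * a.prod fun l n => ρ l ^ n) D) →
      ∃ P : ℝ, P ≤ (∏ j, (1 + d j)) - 1 ∧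
        HasSum (fun a : ℕ →₀ ℕ => ‖MvPowerSeries.coeff a ((∏ j, g j) - 1)‖ * a.prod fun l n => ρ l ^ n) P :=
  fun _ hρ _ g d hg => d1_prod_deviation hρ Finset.univ g d fun j _ => hg j

end Weights

end Summit.KontsevichZagierPeriods.KontsevichZagierPeriods.TypeAGenerationLine
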